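import Summits.QuantumFields.YangMills.Theorems.UnitScaleTiltProp7CentrePinnedHessianPoincareCovFrames
import Summits.QuantumFields.YangMills.Theorems.UnitScaleTiltProp7InterpErrorHarmonicLetters
import HarnessLib

/-!
# Route `UnitScaleTilt`, crux K1 «MinimiserStabilityRegPr» (stmt-QuantumFields-19200), route-R E′ path (α′), (E1-b) covariant — (3.35) FRAMES ON AN ARBITRARY `tdist`-BALL AT THE
# MEMBER OF RECORD, BOTH POINTWISE ROWS: for `W ∈ RegPr` (`M·α₀ ≤ a₅`), every base point `x₀ ∈ T^{(0)}` and every radius `r` with `2r + 4 ≤ bigSide` (so every `r ≤ 18·ℓ_k`),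
# ONE frame `Fr`, bi-contractive everywhere, with `‖(Fr x)⁻¹W(x,μ)Fr(x+e_μ) − 1‖ ≤ τ₁` and `‖h_μ(x + e_ν) − h_μ(x)‖ ≤ τ₂` for ALL `μ, ν` and ALL `x` with `tdist(x, x₀) ≤ r`

Cell `ym3-torus`, width seat `ym3-torus-px4` (gen 3); ★routeR-w3 g6 NAMER WORD (9a) 2026-08-28T21:58:57Z «px4 g3: FRAMES-POINTWISE» (= px11 g3's ASK 3, LOCATE-HK2COV #57): ONE letter
serving px11's F3-cov (the pin ball `B(embIter y₀, ℓ_k∕2)`), ym-routeR-w6 g6's (N-cov) framed transplant (the bond ball `B(b₋, 2ℓ_k + 2)`) and word (6b).  Sibling of ✓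
`Prop7CentrePinnedHessianPoincareCovFrames` (p671512; same chain, window := a `tdist`-ball instead of the 13-cell Hessian window).  THEOREMS ONLY (0 `def`, 0 `sorry`);
`--supports stmt-QuantumFields-19200`, count-neutral.  YM₃ on T³ is a ladder rung (R3), not the Clay problem; nothing here claims a stub, the crux, d = 4 or the mass gap.

THE CHAIN (all by name): `tdist(x, x₀) ≤ r ⇒ x = x₀ + w`, `w ∈ Q_r(0)` (✓ `Prop7InterpErrorHarmonicLetters.exists_eq_transl_of_tdist_le`) `= (x̂₀ + w) mod N` (§1 `transl_eq_intCast`,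
`x̂₀ = val ∘ x₀`) ⟹ ✓ `exists_gridCube_cover_box` (the integer box `Q_r(x̂₀)` with its `{0,1,2}³`-neighbours sits in ONE aligned cube `torusCube c (2·bigSide)`) ⟹ ✓
`gridCube_mem_cubeClass396` ⟹ ✓ `reg335_reg336_T3_of_regPr` ∘ ✓ `reg335_bgT3_iff` (`Reg335Cube` on it) ⟹ ✓ `frame_rows_of_reg335Cube_mixed` ⟹ frame `u⁻¹` on the cube, `1` outside.

WHAT IS PROVED (ns `…Theorems.Prop7MemberBallFrames`).
* §1 `transl_eq_intCast`, `lift_add_mem_box`, `forty_mul_le_bigSide` (`40·L^{K−n} ≤ bigSide`, so `2r + 4 ≤ bigSide` for every `r ≤ 18·L^{K−n}`).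
* §2 ★★★ `exists_ballFrame_of_regPr` — `∃ c35 a₅ > 0, ∀ member, ∀ α₀ > 0, M·α₀ ≤ a₅ → ∀ W, RegPr → ∀ x₀ r, 2r + 4 ≤ bigSide → ∃ Fr, (∀ z, bi-contractive) ∧
  (∀ μ x, tdist x x₀ ≤ r → ‖(Fr x)⁻¹·W(x,μ)·Fr(x+e_μ) − 1‖ ≤ τ₁) ∧ (∀ μ ν x, tdist x x₀ ≤ r → ‖h_μ(x+e_ν) − h_μ(x)‖ ≤ τ₂)` with `τ₁ = ηC′e^{ηC′}`, `τ₂ = η(ηC′)e^{ηC′}`,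
  `η = (L^{K−n})⁻¹`, `C′ = c35·(L·L^{a′})·α₀` — ✓p663714's `a₀, a₁` token-for-token (k-UNIFORM: `τ₁ ≍ α₀∕ℓ_k`, `τ₂ ≍ α₀∕ℓ_k²`).
HONEST SCOPE.  Bookkeeping over landed bricks (same inputs as ✓p671512); the analytic input is [B8] Prop. 6 via ✓ `reg335_reg336_T3_of_regPr`.

References: T. Bałaban, CMP 99 (1985) 75–102 [Balaban1985RegularSpaces] ((1.33) p.82, Prop. 6 p.99); CMP 99 (1985) 389–434 [Balaban1985BackgroundPropagators] ((3.28) p.395, (3.35) p.396);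
CMP 102 (1985) 277–309 [Balaban1985Variational] (Sect. A p.280, Prop. 7 p.299).
-/

set_option autoImplicit false

noncomputable section

open scoped Matrix.Norms.L2Operator

namespace Summit.QuantumFields.YangMills.Theorems.Prop7MemberBallFrames

open Literature.MathematicalPhysics.QuantumFieldTheory.Balaban1983to89
open Literature.MathematicalPhysics.QuantumFieldTheory.Balaban1983to89.T3ContinuumYM3Torus
open Literature.MathematicalPhysics.QuantumFieldTheory.Balaban1983to89.T3PrintedRegularMinimiser (RegPr)
open Literature.MathematicalPhysics.QuantumFieldTheory.Balaban1983to89.B6KLevelCensusIndexV1 (KIdx kGeo)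
open Literature.MathematicalPhysics.QuantumFieldTheory.Balaban1983to89.B6GlobalChartV1 (PV)
open B9Eq3117Current (gaugeTr)
open B9Eq335RegularityClasses (Reg335Cube)
open B4Eq19LatticeOperators (Zd box mem_box unitVec)
open B9TorusCalculus (torusT)
open B9BackgroundsKLevelV1 (torusCube cubeClass396 eta_pos_L_one_le_M_pos)
open B6MultiLevelBoxOperator (bigSide)
open B10Eq27TorusAxialLog (transl transl_apply unitsField toUField)
open LatticeNorms (scaleLen)
open Summit.QuantumFields.YangMills.Theorems.Prop7SectET3Members (hd3 memberIdx hkw)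
open Summit.QuantumFields.YangMills.Theorems.Prop7SectET3BgClass (bgT3 cfgV1OfT3 reg335_bgT3_iff eta_memberIdx M_memberIdx)
open Summit.QuantumFields.YangMills.Theorems.Prop7SectET3ClassTransfer (two_mul_side_add_two_le reg335_reg336_T3_of_regPr)
open Summit.QuantumFields.YangMills.Theorems.Prop7LemmaHCurvedFramesOfRegPr (bigSide_dvd_sitesPerDir gridCube_mem_cubeClass396 scaleLen_eta_memberIdx)
open Summit.QuantumFields.YangMills.Theorems.Prop7CentrePinnedHessianPoincareCovFrames (frame_rows_of_reg335Cube_mixed piecewiseFrameHol_eq piecewiseFrame_bicontr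
  torusT_intCast exists_gridCube_cover_box unitVec_mem unitVec_add_mem)
open Summit.QuantumFields.YangMills.Theorems.Prop7InterpErrorHarmonicLetters (exists_eq_transl_of_tdist_le)

/-! ## §1 Letters: the translate as an integer point read mod `N`; the ball radius budget -/

section Letters

variable {P : Params}

/-- `x₀ + w = (x̂₀ + w) mod N` with `x̂₀ := val ∘ x₀`. [folklore] -/
theorem transl_eq_intCast (x₀ : Site P 0) (w : Zd P.d) :
    transl x₀ w = fun κ => ((((fun κ => ((x₀ κ).val : ℤ)) + w) κ : ℤ) : ZMod (P.sitesPerDir 0)) := by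
  funext κ
  rw [transl_apply, Pi.add_apply]
  push_cast
  rw [ZMod.natCast_zmod_val]

/-- `w ∈ Q_r(0) ⇒ x̂₀ + w ∈ Q_r(x̂₀)`. [folklore] -/
theorem lift_add_mem_box (x₀ : Site P 0) {r : ℤ} {w : Zd P.d} (hw : w ∈ box (0 : Zd P.d) r) :
    (fun κ => ((x₀ κ).val : ℤ)) + w ∈ box (fun κ => ((x₀ κ).val : ℤ)) r := by
  rw [mem_box] at hw ⊢
  intro i
  have := hw i
  simp only [Pi.zero_apply, sub_zero] at this
  simpa using this

end Letters

/-- **THE RADIUS BUDGET**: `40·L^{K−n} ≤ bigSide = L^{a′}·L^{K−n}·L` (`L^{a′} ≥ 8`, `L ≥ 5`) — so `2r + 4 ≤ bigSide` whenever `r ≤ 18·L^{K−n}` (pin balls `ℓ_k∕2`, bond balls `2ℓ_k + 2`, …).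
[cite: Balaban1985BackgroundPropagators, p.396 (bookkeeping)] -/
theorem forty_mul_le_bigSide {ℓ : ℕ} (hℓ : 4 ≤ ℓ) {K n a' : ℕ} (hM8 : 8 ≤ (ℓ + 1) ^ a') :
    40 * (ℓ + 1) ^ (K - n) ≤ bigSide ℓ ((ℓ + 1) ^ a') (K - n) := by
  unfold bigSide
  rw [pow_succ]
  set x := (ℓ + 1) ^ (K - n)
  set a := (ℓ + 1) ^ a'
  have h1 : 8 * (x * 5) ≤ a * (x * (ℓ + 1)) := Nat.mul_le_mul hM8 (Nat.mul_le_mul_left x (by omega))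
  calc 40 * x = 8 * (x * 5) := by ring
    _ ≤ a * (x * (ℓ + 1)) := h1

/-! ## §2 ★★★ The frame on a `tdist`-ball at the member -/

section Member

variable {ℓ : ℕ} {hL : Odd (ℓ + 1) ∧ 1 < ℓ + 1}

/-- ★★★ **(3.35) FRAMES ON A `tdist`-BALL AT THE MEMBER OF RECORD, BOTH POINTWISE ROWS** (see the module docstring): for `W ∈ RegPr` (`M·α₀ ≤ a₅`), every `x₀` and every `r` with
`2r + 4 ≤ bigSide`, a frame `Fr` (bi-contractive everywhere) whose framed links satisfy the SIZE row `τ₁` and the ALL-DIRECTION DIFFERENCE row `τ₂` at every `x` with `tdist(x, x₀) ≤ r`.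
[cite: Balaban1985RegularSpaces, (1.33) p.82, Prop. 6 p.99; Balaban1985BackgroundPropagators, (3.35) p.396, (3.28) p.395; Balaban1985Variational, Sect. A p.280] -/
theorem exists_ballFrame_of_regPr (hℓ4 : 4 ≤ ℓ) :
    ∃ c35 a₅ : ℝ, 0 < c35 ∧ 0 < a₅ ∧
      ∀ (hℓ : 4 ≤ ℓ) (m : ℕ) (hm : 1 ≤ m) (n K a' R : ℕ) (hk1 : 1 ≤ K - n) (hsize : a' + 3 ≤ m + n) (hM8 : 8 ≤ (ℓ + 1) ^ a')
        (hR2 : 2 * (ℓ + 1) ^ 2 ≤ R) (α₀ : ℝ), 0 < α₀ → ((ℓ + 1 : ℕ) : ℝ) * (((ℓ + 1) ^ a' : ℕ) : ℝ) * α₀ ≤ a₅ →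
        ∀ W : GaugeField (PV 2 ℓ m K hd3 hL) 0 (Matrix.specialUnitaryGroup (Fin 2) ℂ),
          RegPr (⟨ℓ + 1, hL, m, hm⟩ : T3Family) n K α₀ W →
          ∀ (x₀ : Site (PV 2 ℓ m K hd3 hL) 0) (r : ℕ), 2 * r + 4 ≤ bigSide ℓ ((ℓ + 1) ^ a') (K - n) →
            ∃ Fr : Site (PV 2 ℓ m K hd3 hL) 0 → (Matrix (Fin 2) (Fin 2) ℂ)ˣ,
              (∀ z : Site (PV 2 ℓ m K hd3 hL) 0, ‖(Fr z : Matrix (Fin 2) (Fin 2) ℂ)‖ ≤ 1 ∧ ‖(((Fr z)⁻¹ : (Matrix (Fin 2) (Fin 2) ℂ)ˣ) : Matrix (Fin 2) (Fin 2) ℂ)‖ ≤ 1) ∧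
              (∀ (μ : Fin (PV 2 ℓ m K hd3 hL).d) (x : Site (PV 2 ℓ m K hd3 hL) 0), Site.tdist x x₀ ≤ r →
                ‖(((Fr x)⁻¹ * unitsField (toUField W) ⟨x, μ⟩ * Fr (torusT (PV 2 ℓ m K hd3 hL) 0 μ x) : (Matrix (Fin 2) (Fin 2) ℂ)ˣ) : Matrix (Fin 2) (Fin 2) ℂ) - 1‖
                  ≤ (((ℓ + 1 : ℕ) : ℝ) ^ (K - n))⁻¹ * (c35 * (((ℓ + 1 : ℕ) : ℝ) * (((ℓ + 1) ^ a' : ℕ) : ℝ)) * α₀)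
                      * Real.exp ((((ℓ + 1 : ℕ) : ℝ) ^ (K - n))⁻¹ * (c35 * (((ℓ + 1 : ℕ) : ℝ) * (((ℓ + 1) ^ a' : ℕ) : ℝ)) * α₀))) ∧
              (∀ (μ ν : Fin (PV 2 ℓ m K hd3 hL).d) (x : Site (PV 2 ℓ m K hd3 hL) 0), Site.tdist x x₀ ≤ r →
                ‖(((Fr (torusT (PV 2 ℓ m K hd3 hL) 0 ν x))⁻¹ * unitsField (toUField W) ⟨torusT (PV 2 ℓ m K hd3 hL) 0 ν x, μ⟩
                      * Fr (torusT (PV 2 ℓ m K hd3 hL) 0 μ (torusT (PV 2 ℓ m K hd3 hL) 0 ν x)) : (Matrix (Fin 2) (Fin 2) ℂ)ˣ) : Matrix (Fin 2) (Fin 2) ℂ)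
                    - (((Fr x)⁻¹ * unitsField (toUField W) ⟨x, μ⟩ * Fr (torusT (PV 2 ℓ m K hd3 hL) 0 μ x) : (Matrix (Fin 2) (Fin 2) ℂ)ˣ) : Matrix (Fin 2) (Fin 2) ℂ)‖
                  ≤ (((ℓ + 1 : ℕ) : ℝ) ^ (K - n))⁻¹ * ((((ℓ + 1 : ℕ) : ℝ) ^ (K - n))⁻¹ * (c35 * (((ℓ + 1 : ℕ) : ℝ) * (((ℓ + 1) ^ a' : ℕ) : ℝ)) * α₀))
                      * Real.exp ((((ℓ + 1 : ℕ) : ℝ) ^ (K - n))⁻¹ * (c35 * (((ℓ + 1 : ℕ) : ℝ) * (((ℓ + 1) ^ a' : ℕ) : ℝ)) * α₀))) := by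
  classical
  obtain ⟨c35, a₅, hc35, ha₅, H⟩ := reg335_reg336_T3_of_regPr ℓ hL hℓ4
  refine ⟨c35, a₅, hc35, ha₅, ?_⟩
  intro hℓ m hm n K a' R hk1 hsize hM8 hR2 α₀ hα₀ hMα W hreg x₀ r hr
  set i := memberIdx ℓ hL hℓ m hm n K a' R hk1 hsize hM8 hR2 with hi
  have h335 := ((reg335_bgT3_iff i c35 α₀ W).1 (H hℓ m hm n K a' R hk1 hsize hM8 hR2 α₀ hα₀ hMα W hreg c35 le_rfl).1)
  -- one aligned cube of side `2B` around the ball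
  set B := bigSide ℓ ((ℓ + 1) ^ a') (K - n) with hB
  have hBpos : 0 < B := by omega
  have hBN : B ∣ (PV 2 ℓ m K hd3 hL).sitesPerDir 0 := bigSide_dvd_sitesPerDir (hL := hL) hℓ m n K a' hk1 hsize
  have h2B2 : 2 * (2 * B) + 2 ≤ (PV 2 ℓ m K hd3 hL).sitesPerDir 0 := two_mul_side_add_two_le (hL := hL) hℓ m n K a' hk1 hsize (n' := 2) (by norm_num)
  have h2B : 2 * B ≤ (PV 2 ℓ m K hd3 hL).sitesPerDir 0 := by omega
  obtain ⟨c, hc, hcov⟩ := exists_gridCube_cover_box (P := PV 2 ℓ m K hd3 hL) B hBpos hBN h2B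
    (fun κ : Fin (PV 2 ℓ m K hd3 hL).d => (((x₀ κ).val : ℤ))) r hr
  have hq := gridCube_mem_cubeClass396 (hL := hL) hℓ m hm n K a' R hk1 hsize hM8 hR2 c hc
  have hη : 0 < (kGeo i).eta := (eta_pos_L_one_le_M_pos i).1
  have hReg : Reg335Cube (torusT (PV 2 ℓ m K hd3 hL) 0) (fun κ z => unitsField (toUField W) ⟨z, κ⟩) (kGeo i).eta (torusCube c (2 * B))
      (scaleLen ((ℓ + 1 : ℕ) : ℝ) (kGeo i).eta (K - n)) (c35 * (kGeo i).M * α₀) := h335 _ hq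
  obtain ⟨u, hu, hsize', hmixed⟩ := frame_rows_of_reg335Cube_mixed (torusT (PV 2 ℓ m K hd3 hL) 0) (fun κ z => unitsField (toUField W) ⟨z, κ⟩) hη hReg
  have hξ : scaleLen ((ℓ + 1 : ℕ) : ℝ) (kGeo i).eta (K - n) = 1 := scaleLen_eta_memberIdx (hL := hL) hℓ m hm n K a' R hk1 hsize hM8 hR2
  have hηe : (kGeo i).eta = ((((ℓ + 1 : ℕ) : ℝ)) ^ (K - n))⁻¹ := eta_memberIdx hℓ m hm n K a' R hk1 hsize hM8 hR2
  have hMe : (kGeo i).M = ((ℓ + 1 : ℕ) : ℝ) * (((ℓ + 1) ^ a' : ℕ) : ℝ) := M_memberIdx hℓ m hm n K a' R hk1 hsize hM8 hR2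
  rw [hξ, inv_one, mul_one, hηe, hMe] at hsize'
  rw [hξ, one_pow, inv_one, mul_one, hηe, hMe] at hmixed
  refine ⟨fun z => if z ∈ torusCube c (2 * B) then (u z)⁻¹ else 1, piecewiseFrame_bicontr (torusCube c (2 * B)) u hu, ?_, ?_⟩
  · intro μ x hx
    obtain ⟨w, hw, hxw⟩ := exists_eq_transl_of_tdist_le x₀ x hx
    set N := (PV 2 ℓ m K hd3 hL).sitesPerDir 0 with hN
    have hz : (fun κ => ((x₀ κ).val : ℤ)) + w ∈ box (fun κ : Fin (PV 2 ℓ m K hd3 hL).d => ((x₀ κ).val : ℤ)) r := lift_add_mem_box x₀ hw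
    have hcast : ∀ e : Zd (PV 2 ℓ m K hd3 hL).d, (∀ κ, 0 ≤ e κ ∧ e κ ≤ 2) →
        (fun κ => ((((fun κ => ((x₀ κ).val : ℤ)) + w + e) κ : ℤ) : ZMod N)) ∈ torusCube c (2 * B) := fun e he => hcov _ hz e he
    have hxc : x = fun κ => ((((fun κ => ((x₀ κ).val : ℤ)) + w) κ : ℤ) : ZMod N) := by rw [hxw, transl_eq_intCast]
    have hx0 : x ∈ torusCube c (2 * B) := by
      have := hcast 0 (fun κ => by simp); rw [add_zero] at this; rw [hxc]; exact this
    have hx1 : torusT (PV 2 ℓ m K hd3 hL) 0 μ x ∈ torusCube c (2 * B) := by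
      rw [hxc, torusT_intCast]; exact hcast (unitVec μ) (unitVec_mem μ)
    rw [piecewiseFrameHol_eq (torusT (PV 2 ℓ m K hd3 hL) 0) (fun κ z => unitsField (toUField W) ⟨z, κ⟩) (torusCube c (2 * B)) u μ x hx0 hx1]
    exact hsize' μ x hx0
  · intro μ ν x hx
    obtain ⟨w, hw, hxw⟩ := exists_eq_transl_of_tdist_le x₀ x hx
    set N := (PV 2 ℓ m K hd3 hL).sitesPerDir 0 with hN
    have hz : (fun κ => ((x₀ κ).val : ℤ)) + w ∈ box (fun κ : Fin (PV 2 ℓ m K hd3 hL).d => ((x₀ κ).val : ℤ)) r := lift_add_mem_box x₀ hw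
    have hcast : ∀ e : Zd (PV 2 ℓ m K hd3 hL).d, (∀ κ, 0 ≤ e κ ∧ e κ ≤ 2) →
        (fun κ => ((((fun κ => ((x₀ κ).val : ℤ)) + w + e) κ : ℤ) : ZMod N)) ∈ torusCube c (2 * B) := fun e he => hcov _ hz e he
    have hxc : x = fun κ => ((((fun κ => ((x₀ κ).val : ℤ)) + w) κ : ℤ) : ZMod N) := by rw [hxw, transl_eq_intCast]
    have hx0 : x ∈ torusCube c (2 * B) := by
      have := hcast 0 (fun κ => by simp); rw [add_zero] at this; rw [hxc]; exact this
    have hx1 : ∀ κ' : Fin (PV 2 ℓ m K hd3 hL).d, torusT (PV 2 ℓ m K hd3 hL) 0 κ' x ∈ torusCube c (2 * B) := by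
      intro κ'; rw [hxc, torusT_intCast]; exact hcast (unitVec κ') (unitVec_mem κ')
    have hx2 : torusT (PV 2 ℓ m K hd3 hL) 0 μ (torusT (PV 2 ℓ m K hd3 hL) 0 ν x) ∈ torusCube c (2 * B) := by
      rw [hxc, torusT_intCast, torusT_intCast, add_assoc]; exact hcast (unitVec ν + unitVec μ) (unitVec_add_mem ν μ)
    rw [piecewiseFrameHol_eq (torusT (PV 2 ℓ m K hd3 hL) 0) (fun κ z => unitsField (toUField W) ⟨z, κ⟩) (torusCube c (2 * B)) u μ _ (hx1 ν) hx2,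
      piecewiseFrameHol_eq (torusT (PV 2 ℓ m K hd3 hL) 0) (fun κ z => unitsField (toUField W) ⟨z, κ⟩) (torusCube c (2 * B)) u μ x hx0 (hx1 μ)]
    exact hmixed ν μ x hx0 (hx1 ν)

end Member

end Summit.QuantumFields.YangMills.Theorems.Prop7MemberBallFrames

end
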